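import Mathlib
import Summits.NavierStokesRegularity.TurbBounds.SpectralFormFreeSlip
import Summits.NavierStokesRegularity.TurbBounds.FSU1.Corner

/-!
# FS-U1″ mode lemma — Defs (`TurbBounds/FSU1/Mode/M03Defs.lean`)

The unscaled objects `μ, M, g₊, P, Q, ε₁, m̃`, the even bracket, `W_half`, `E_half`, `E₁`, the parity classes, `‖H_ρ‖²`, `J(ρ)`, and the seven analysis statements (all PROVED below: Parity M07, Coupling M08–M09, Major M10–M11, Stiffness M12–M13).

Cell-made mathematics of FS-PROOF-DRAFT §3 (pub-turb-sos), kernel-checked; generated from the design compose file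
`StageF_compose.check.lean` (96c4b9bf…) by `build_mode_split.py`.  HONEST FRAMING: rigorous bounds for the stated PDE and boundary conditions; no claim about physical turbulence beyond the bound.
-/

open Real intervalIntegral MeasureTheory Set

namespace Summit.NavierStokesRegularity.TurbBounds.FSU1.Mode

open Summit.NavierStokesRegularity.TurbBounds.SpectralFormFreeSlip
open Summit.NavierStokesRegularity.TurbBounds.FSU1

/-! ## A.1 Unscaled objects (variables `α = a Ra^{-3/2}`, `β₀ = b' Ra^{-1}`, `δ`, `k`) -/

/-- `μ = √(k² + β₀/α)`. -/
noncomputable def muR (α β₀ k : ℝ) : ℝ := Real.sqrt (k ^ 2 + β₀ / α)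
/-- The half-cell (odd-class) stiffness constant `M = k/(2α(k+μ)²)`: `V'(0)² ≤ M·W_half`. -/
noncomputable def Mhalf (α β₀ k : ℝ) : ℝ := k / (2 * α * (k + muR α β₀ k) ^ 2)
/-- `g₊(k) = 2e^{-k}(k-1-e^{-k})/(1+e^{-k})²` (even-class correction). -/
noncomputable def gplus (k : ℝ) : ℝ :=
  2 * Real.exp (-k) * (k - 1 - Real.exp (-k)) / (1 + Real.exp (-k)) ^ 2
/-- `P = (μ+k)/2`, `Q = (μ-k)/2`. -/
noncomputable def Pof (α β₀ k : ℝ) : ℝ := (muR α β₀ k + k) / 2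
/-- `Q = (μ − k)/2` (half-difference of the two roots; decay rate of the slow exponential). -/
noncomputable def Qof (α β₀ k : ℝ) : ℝ := (muR α β₀ k - k) / 2
/-- `ε₁ = (e^{-P}+e^{-Q})/sinh P`. -/
noncomputable def eps1 (α β₀ k : ℝ) : ℝ :=
  (Real.exp (-Pof α β₀ k) + Real.exp (-Qof α β₀ k)) / Real.sinh (Pof α β₀ k)
/-- `m̃ = μ/k`. -/
noncomputable def mtR (α β₀ k : ℝ) : ℝ := muR α β₀ k / k
/-- The even-class bracket `1 + g₊(m̃+1)/(m̃-1) + 2ε₁/(m̃-1)`. -/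
noncomputable def evenBracket (α β₀ k : ℝ) : ℝ :=
  1 + gplus k * ((mtR α β₀ k + 1) / (mtR α β₀ k - 1)) + 2 * eps1 α β₀ k / (mtR α β₀ k - 1)
/-- Half-cell vorticity energy `W_half = ∫₀^{1/2} (αΩ'² + (αk²+β₀)Ω²)`, `Ω = vort k V`. -/
noncomputable def Wh (α β₀ k : ℝ) (V : ℝ → ℝ) : ℝ :=
  ∫ z in (0:ℝ)..1/2, (α * deriv (vort k V) z ^ 2 + (α * k ^ 2 + β₀) * vort k V z ^ 2)
/-- Half-cell reduced form `E_half = ∫₀^{1/2}(Θ'² + αΩ'² + (αk²+β₀)Ω²) − (1/δ)∫₀^δ VΘ`. -/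
noncomputable def Eh (α β₀ δ k : ℝ) (V Θ : ℝ → ℝ) : ℝ :=
  (∫ z in (0:ℝ)..1/2, (deriv Θ z ^ 2 + α * deriv (vort k V) z ^ 2 + (α * k ^ 2 + β₀) * vort k V z ^ 2))
    - 1 / δ * ∫ z in (0:ℝ)..δ, V z * Θ z
/-- Full-cell reduced form `E₁ = ∫₀¹ (θ'² + αΩ'² + (αk²+β₀)Ω² + 2τ' v θ)` (= `Eu 1` of the Young split, see `Eu_one_eq_E1`). -/
noncomputable def E1 (α β₀ : ℝ) (τp : ℝ → ℝ) (k : ℝ) (v θ : ℝ → ℝ) : ℝ :=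
  ∫ z in (0:ℝ)..1, (deriv θ z ^ 2 + α * deriv (vort k v) z ^ 2 + (α * k ^ 2 + β₀) * vort k v z ^ 2
    + 2 * τp z * v z * θ z)

/-- Even symmetry class on the half cell `[0,1/2]` (profiles even about `z = 1/2`: `V'(1/2) = V'''(1/2) = 0`). -/
structure HalfEven (V Θ : ℝ → ℝ) : Prop where
  hV : ContDiff ℝ 3 V
  hΘ : ContDiff ℝ 1 Θ
  V0 : V 0 = 0
  V2 : deriv (deriv V) 0 = 0
  Θ0 : Θ 0 = 0
  Vmid : deriv V (1 / 2) = 0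
  V3mid : deriv (deriv (deriv V)) (1 / 2) = 0

/-- Odd symmetry class on the half cell (profiles odd about `z = 1/2`). -/
structure HalfOdd (V Θ : ℝ → ℝ) : Prop where
  hV : ContDiff ℝ 3 V
  hΘ : ContDiff ℝ 1 Θ
  V0 : V 0 = 0
  V2 : deriv (deriv V) 0 = 0
  Θ0 : Θ 0 = 0
  Vmid : V (1 / 2) = 0
  V2mid : deriv (deriv V) (1 / 2) = 0
  Θmid : Θ (1 / 2) = 0

/-- `‖H_ρ‖² = ∫₀¹ ((cosh ρ − cosh ρs)/ρ²)² ds`. -/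
noncomputable def HnormSq (ρ : ℝ) : ℝ :=
  ∫ s in (0:ℝ)..1, ((Real.cosh ρ - Real.cosh (ρ * s)) / ρ ^ 2) ^ 2
/-- `J(ρ) = ∫₀¹∫₀¹ (cosh ρ(1−σ) − cosh ρ(max σ u − σ))² du dσ` (remainder-kernel norm). -/
noncomputable def Jfun (ρ : ℝ) : ℝ :=
  ∫ σ in (0:ℝ)..1, ∫ u in (0:ℝ)..1, (Real.cosh (ρ * (1 - σ)) - Real.cosh (ρ * (max σ u - σ))) ^ 2

/-! ## A.2 The seven analysis hypotheses (closed Props) -/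

/-- §3.4: parity splitting about `z = 1/2` reduces `E₁ ≥ 0` on `FreeSlipPair` to the two half-cell classes. -/
def ParityReduction : Prop :=
  ∀ (α β₀ δ k : ℝ) (τp : ℝ → ℝ), 0 < α → 0 < β₀ → 0 < δ → δ ≤ 1 / 2 → 0 < k →
    EqOn τp (fun _ => -(1 / (2 * δ))) (Ioo 0 δ) → EqOn τp (fun _ => (0 : ℝ)) (Ioo δ (1 - δ)) →
    EqOn τp (fun _ => -(1 / (2 * δ))) (Ioo (1 - δ) 1) →
    (∀ V Θ : ℝ → ℝ, HalfEven V Θ → 0 ≤ Eh α β₀ δ k V Θ) →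
    (∀ V Θ : ℝ → ℝ, HalfOdd V Θ → 0 ≤ Eh α β₀ δ k V Θ) →
    ∀ v θ : ℝ → ℝ, FreeSlipPair v θ → 0 ≤ E1 α β₀ τp k v θ

/-- §3.6 even class (`V` even about `z = 1/2`, i.e. `V'(1/2) = V'''(1/2) = 0`):
`V'(0)² ≤ M · [1 + g₊(m̃+1)/(m̃−1) + 2ε₁/(m̃−1)] · W_half`. -/
def StiffnessEven : Prop :=
  ∀ (α β₀ k : ℝ) (V : ℝ → ℝ), 0 < α → 0 < β₀ → 0 < k → ContDiff ℝ 3 V → V 0 = 0 → deriv (deriv V) 0 = 0 →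
    deriv V (1 / 2) = 0 → deriv (deriv (deriv V)) (1 / 2) = 0 →
    deriv V 0 ^ 2 ≤ Mhalf α β₀ k * evenBracket α β₀ k * Wh α β₀ k V

/-- §3.6 odd class (`V` odd about `z = 1/2`, i.e. `V(1/2) = V''(1/2) = 0`): `V'(0)² ≤ M · W_half`. -/
def StiffnessOdd : Prop :=
  ∀ (α β₀ k : ℝ) (V : ℝ → ℝ), 0 < α → 0 < β₀ → 0 < k → ContDiff ℝ 3 V → V 0 = 0 → deriv (deriv V) 0 = 0 →
    V (1 / 2) = 0 → deriv (deriv V) (1 / 2) = 0 → deriv V 0 ^ 2 ≤ Mhalf α β₀ k * Wh α β₀ k V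

/-- §3.7 slope part: `|(1/δ)∫₀^δ (S/k) sinh(kz) Θ| ≤ √(δ³‖H_{kδ}‖²)·|S|·‖Θ'‖_{L²(0,δ)}`. -/
def CouplingSlope : Prop :=
  ∀ (δ k S : ℝ) (Θ : ℝ → ℝ), 0 < δ → 0 < k → ContDiff ℝ 1 Θ → Θ 0 = 0 →
    |1 / δ * ∫ z in (0:ℝ)..δ, S / k * Real.sinh (k * z) * Θ z|
      ≤ Real.sqrt (δ ^ 3 * HnormSq (k * δ)) * |S| * Real.sqrt (∫ z in (0:ℝ)..δ, deriv Θ z ^ 2)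

/-- §3.7 remainder part: `|(1/δ)∫₀^δ (V − (V'(0)/k) sinh kz) Θ| ≤ (√J(kδ)/k)·‖Ω‖_{L²(0,δ)}·‖Θ'‖_{L²(0,δ)}`. -/
def CouplingRemainder : Prop :=
  ∀ (δ k : ℝ) (V Θ : ℝ → ℝ), 0 < δ → 0 < k → ContDiff ℝ 3 V → V 0 = 0 → ContDiff ℝ 1 Θ → Θ 0 = 0 →
    |1 / δ * ∫ z in (0:ℝ)..δ, (V z - deriv V 0 / k * Real.sinh (k * z)) * Θ z|
      ≤ Real.sqrt (Jfun (k * δ)) / k * Real.sqrt (∫ z in (0:ℝ)..δ, vort k V z ^ 2)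
          * Real.sqrt (∫ z in (0:ℝ)..δ, deriv Θ z ^ 2)

/-- The majorant of record for `‖H_ρ‖²` on `[0,1]`. -/
def MajorH : Prop := ∀ ρ : ℝ, 0 ≤ ρ → ρ ≤ 1 → HnormSq ρ ≤ PH ρ
/-- The majorant of record for `J(ρ)/ρ⁴` on `[0,1]`. -/
def MajorJ : Prop := ∀ ρ : ℝ, 0 ≤ ρ → ρ ≤ 1 → Jfun ρ ≤ ρ ^ 4 * PJ ρ

end Summit.NavierStokesRegularity.TurbBounds.FSU1.Mode
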